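import Summits.BirchSwinnertonDyer.BirchSwinnertonDyer.Theorems.ResidualThetaTransportAtTwoThetaLayerLambdaCongruenceAtTwoOfBz
import Literature.NumberTheory.EllipticCurves.ModularJacobianGaloisCharpolyRel
import HarnessLib

/-!
# Kan⁺ `ThetaLayerLambdaCongruenceAtTwo` from a Galois datum with Eichler–Shimura and the `J₁(N)` input

Crux `stmt-BirchSwinnertonDyer-20688` (route `ResidualThetaTransportAtTwo`) closes from Buzzard 2000 Prop. 2.4
ALONE (`thetaLayerLambdaCongruenceAtTwo_of_bz`, PUB¹). This file composes that closer with the KERNEL reduction of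
the print input (`Literature/NumberTheory/EllipticCurves/ModularJacobianGaloisCharpolyRel.lean`,
`…/ModularJacobianMultiplicityOneOfGaloisDatum.lean`, `Literature/Algebra/GroupRings/CharpolyQuotientRankTwo*.lean`):
Boston–Lenstra–Ribet (ring, module, residue-field descent), Burnside, the multiplicity assembly, `J₀(N)[𝔪] ≠ 0`, the
`𝕋/𝔪`-linear Galois action on `J₀(N)[𝔪]` with open kernel and — via the tree's proved Chebotarev — the [BLR] relations
from the Eichler–Shimura relation at Frobenius are ALL theorems; what remains of Buzzard's proof is displayed as the
single hypothesis of `thetaLayerLambdaCongruenceAtTwo_of_galoisData`: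

* a `ℚ`-structure datum `D : ModularJacobianGaloisData N ιℂ` (cited existence `nonempty_modularJacobianGaloisData`)
  satisfying Eichler–Shimura `φ² − T_p φ + p = 0` on `J₀(N)[2]` at arithmetic Frobenii above `p ∤ 2N`
  (Darmon–Diamond–Taylor Thm. 1.29; named fact `nonempty_modularJacobianGaloisData_eichlerShimura`, review pending), and
* for the resulting representation `σ` on `J0 N[𝔪]`, a `σ`-stable `𝕋/𝔪`-subspace `U` with commuting action and
  `dim (J0 N[𝔪] ⧸ U) ≤ 2` — in print `J₀(N)[𝔪] ∩ ker(J₀(N) → J₁(N))`, abelian by Buzzard's Lemma 2.3 (Ling–Oesterlé)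
  and of codimension `≤ 2` by Thm. 6.1 of Buzzard's appendix to Ribet–Stein (`dim J₁(N)[𝔪] = 2`, ⟸ Edixhoven 1992).

HONESTY: CONDITIONAL — Kan⁺ is NOT settled by this file and BSD is not proved by any of this; the crux's floor is
unchanged in substance (Bz, print) but is now typed down to {Eichler–Shimura (standard), the `J₁(N)` input (XL)}.
-/

set_option autoImplicit false

noncomputable section

-- justification: the `Summit.BirchSwinnertonDyer.BirchSwinnertonDyer.…` path repeats a component (route-file convention)
set_option linter.dupNamespace false

open scoped MatrixGroups NumberField ModularForm
open CongruenceSubgroup IsDedekindDomain Rat.HeightOneSpectrum Polynomial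
open Literature.NumberTheory.EllipticCurves.ModularForms Literature.NumberTheory.GaloisRepresentations
open Summit.BirchSwinnertonDyer.BirchSwinnertonDyer.Theses.ResidualThetaTransportAtTwo

namespace Summit.BirchSwinnertonDyer.BirchSwinnertonDyer.Theorems.ThetaLayerLambdaCongruenceAtTwo

/-- **Kan⁺ `ThetaLayerLambdaCongruenceAtTwo` BY NAME from a Galois datum with Eichler–Shimura and the `J₁(N)`
input** — `thetaLayerLambdaCongruenceAtTwo_of_bz` composed with the kernel reduction
`buzzard2000_multiplicityOne_gamma0_of_galoisData` of Buzzard 2000 Prop. 2.4. The hypothesis is, for every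
instance of Buzzard's binders (`N` odd, `𝔪 ∋ 2` maximal, `k ⊇ 𝕋/𝔪` algebraically closed, `ρ ≅ ρ_𝔪` irreducible
and non-scalar on `D₂`): an embedding `ℚ̄ → ℂ` and a `ℚ`-structure datum on `J0.tors N` with Eichler–Shimura on
`J₀(N)[2]` above `p ∤ 2N`, and, for the `𝕋/𝔪`-linear Galois representation `σ` on `J0 N[𝔪]` it induces, a
`σ`-stable subspace with commuting action and codimension `≤ 2`. CONDITIONAL; Kan⁺ is NOT settled and BSD is not
proved by this. [cite: Buzzard2000LevelLoweringModTwo, Lemma 2.3 and proof of Prop. 2.4 (p. 101)]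
[cite: DarmonDiamondTaylor1995, Thm. 1.29 (p. 37) and §4.5 (p. 135)] -/
theorem thetaLayerLambdaCongruenceAtTwo_of_galoisData
    (hD : ∀ (N : ℕ) [NeZero N], Odd N →
      ∀ (𝔪 : Ideal (HeckeRing0 N 2)), 𝔪.IsMaximal → (2 : HeckeRing0 N 2) ∈ 𝔪 →
      ∀ (k : Type) [Field k] [IsAlgClosed k] [TopologicalSpace k] [DiscreteTopology k]
        (ι : HeckeRing0 N 2 ⧸ 𝔪 →+* k) (ρ : ModPGaloisRep ℚ k 2),
        (∀ v : HeightOneSpectrum (𝓞 ℚ), ¬ ((primesEquiv v : Nat.Primes) : ℕ) ∣ 2 * N →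
          ρ.IsUnramifiedAt v ∧
            ρ.HasFrobCharpolyAt v
              (X ^ 2
                - C (ι (Ideal.Quotient.mk 𝔪 (HeckeRing0.T N 2
                    ((primesEquiv v : Nat.Primes) : ℕ) (primesEquiv v : Nat.Primes).2))) * X
                + C (((primesEquiv v : Nat.Primes) : ℕ) : k))) →
        FramedRep.IsIrreducible ρ →
        (∀ v : HeightOneSpectrum (𝓞 ℚ), ((primesEquiv v : Nat.Primes) : ℕ) = 2 →
          ∀ 𝔓 ∈ v.primesAbove, ∃ σ ∈ 𝔓.decompositionSubgroup (Field.absoluteGaloisGroup ℚ),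
            ∀ c : k, ((ρ σ : GL (Fin 2) k) : Matrix (Fin 2) (Fin 2) k) ≠ Matrix.scalar (Fin 2) c) →
        ∃ (ιℂ : AlgebraicClosure ℚ →+* ℂ) (D : ModularJacobianGaloisData N ιℂ),
          (∀ v : HeightOneSpectrum (𝓞 ℚ), ¬ ((primesEquiv v : Nat.Primes) : ℕ) ∣ 2 * N →
            ∀ 𝔓 ∈ v.primesAbove, ∀ φ : Field.absoluteGaloisGroup ℚ, IsArithFrobAt (𝓞 ℚ) φ 𝔓 →
            ∀ x : J0.tors N, (2 : HeckeRing0 N 2) • x = 0 →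
              D.galAct φ (D.galAct φ x)
                - (HeckeRing0.T N 2 ((primesEquiv v : Nat.Primes) : ℕ)
                    (primesEquiv v : Nat.Primes).2) • D.galAct φ x
                + (((primesEquiv v : Nat.Primes) : ℕ) : HeckeRing0 N 2) • x = 0) ∧
          ∀ σ : Representation (HeckeRing0 N 2 ⧸ 𝔪) (Field.absoluteGaloisGroup ℚ)
              (Submodule.torsionBySet (HeckeRing0 N 2) (J0 N) 𝔪),
            (∀ (g : Field.absoluteGaloisGroup ℚ)
                (x : Submodule.torsionBySet (HeckeRing0 N 2) (J0 N) 𝔪) (x' : J0.tors N),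
                (x' : J0 N) = x →
                ((σ g x : Submodule.torsionBySet (HeckeRing0 N 2) (J0 N) 𝔪) : J0 N)
                  = ((D.galAct g x' : J0.tors N) : J0 N)) →
            ∃ U : Submodule (HeckeRing0 N 2 ⧸ 𝔪) (Submodule.torsionBySet (HeckeRing0 N 2) (J0 N) 𝔪),
              (∀ (g : Field.absoluteGaloisGroup ℚ), ∀ x ∈ U, σ g x ∈ U) ∧
              (∀ (g h : Field.absoluteGaloisGroup ℚ), ∀ x ∈ U, σ g (σ h x) = σ h (σ g x)) ∧
              Module.finrank (HeckeRing0 N 2 ⧸ 𝔪)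
                (Submodule.torsionBySet (HeckeRing0 N 2) (J0 N) 𝔪 ⧸ U) ≤ 2) :
    ThetaLayerLambdaCongruenceAtTwo :=
  thetaLayerLambdaCongruenceAtTwo_of_bz (buzzard2000_multiplicityOne_gamma0_of_galoisData hD)

end Summit.BirchSwinnertonDyer.BirchSwinnertonDyer.Theorems.ThetaLayerLambdaCongruenceAtTwo

end
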